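import Summits.CriticalPhenomena.PercolationContinuityZ3.Theorems.FK.InfiniteVolumeOneEdgeDLRClosed
import Literature.Probability.Percolation.BondCentralInequality
import Mathlib.MeasureTheory.Function.ConditionalExpectation.Basic
import HarnessLib

/-!
# FK-continuity transplant, FO-06 (construction half): the DLR (Gibbs) property of the box limits
# `φ^b_{p,q}` in the one-edge form — Grimmett 2006, (4.30)/(4.38) as a conditional expectation

Cell `fk-continuity` (bschramm), row FO-06b-5; support file for the FK-continuity transplant
(`--supports stmt-CriticalPhenomena-4575`); builds on p205010 (kernel theorem, internal audit signed;
external expert review pending). No named facts, no sorries, standard axioms. General dimension `d`,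
both boundary conditions `b`.

Grimmett 2006, Def. (4.29) eq. (4.30) / Prop. (4.37) eq. (4.38): a measure `φ` is a DLR random-cluster
measure iff for every edge `e = ⟨x,y⟩`, `φ(J_e | T_e) = φ^ω_{e,p,q}(J_e)` a.s., where `T_e` is the
σ-field generated by the states of the edges other than `e`, and the one-edge kernel is `p` on
`K_e = {x ↔ y off e}` and `p/(p + q(1-p))` off `K_e`. `InfiniteVolumeOneEdgeDLRClosed.lean` proves this
for the box limits `P` (`IsBoxLimit d b p q P`, `0 ≤ p ≤ 1`, `q ≥ 1`; hypothesis-free, the a.s.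
uniqueness of the infinite cluster being the cell's Burton–Keane theorem) integrated against events `H ∈ T_e` depending on finitely many edges. Here:

* `IsBoxLimit.real_edgeOpen_inter_preimage_eq` — the same against EVERY `T_e`-measurable event
  (every `(· ∖ e)⁻¹ H₀`, `H₀` measurable), by uniqueness of measures agreeing on local events
  (`ext_of_isLocalEvent`);
* `IsBoxLimit.real_edgeOpen_eq_mul_add` — the edge density `P(e open) = p·P(K_e) + p'·P(K_eᶜ)` (`H = Ω`);
* `IsBoxLimit.condExp_indicator_edgeOpen` — **the conditional-expectation form**
  `P[1_{J_e} | T_e] = (ω ↦ p·1[ω ∖ e ∈ K] + p/(p+q(1-p))·1[ω ∖ e ∉ K])` a.e., with `T_e` realised as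
  the pull-back σ-algebra `MeasurableSpace.comap (· ∖ {e})`, i.e. literally (4.30) for the region `{e}`.

## References

* G. Grimmett, *The Random-Cluster Model*, Springer 2006: Def. (4.29)–(4.30) p. 81, Thm. (4.34)(b),
  Prop. (4.37) eq. (4.38) p. 82. [Grimmett2006]
-/

noncomputable section

open MeasureTheory Set Filter
open scoped Topology ENNReal

namespace Summit.CriticalPhenomena.PercolationContinuityZ3.Theorems.FK

open Literature.Probability.Percolation Literature.Probability.LatticeModels

variable {d : ℕ}

section General

variable {b : Bool} {p q : ℝ} {P : Measure (BondConfig (Site d))}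

/-- **The one-edge DLR equation against every `T_e`-measurable event** (Grimmett 2006, (4.30) for
`Λ = {e}` / (4.38)): for every box limit `P` (`0 ≤ p ≤ 1`, `q ≥ 1`, either boundary condition),
a lattice edge `e = ⟨x,y⟩` and EVERY measurable `H₀`,
`P({e open} ∩ {ω ∖ e ∈ H₀}) = p · P({ω ∖ e ∈ H₀ ∩ K}) + p/(p+q(1-p)) · P({ω ∖ e ∈ H₀ ∖ K})`, `K = {x ↔ y}`.
(The events `{ω ∖ e ∈ H₀}` are exactly the `T_e`-measurable ones.) Extension of
`IsBoxLimit.real_edgeOpen_inter_eq` from local `H₀` by `ext_of_isLocalEvent`.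
[cite: Grimmett2006, Def. (4.29)–(4.30), Thm. (4.34)(b), Prop. (4.37) eq. (4.38)] -/
theorem IsBoxLimit.real_edgeOpen_inter_preimage_eq (hP : IsBoxLimit d b p q P)
    (hp : p ∈ Set.Icc (0 : ℝ) 1) (hq : 1 ≤ q) {x y : Site d} (hxy : (zdGraph d).Adj x y) {H₀ : Set (BondConfig (Site d))}
    (hH₀ : MeasurableSet H₀) :
    P.real ({ω | s(x, y) ∈ ω} ∩ (fun η => η \ {s(x, y)}) ⁻¹' H₀) =
      p * P.real ((fun η => η \ {s(x, y)}) ⁻¹' (H₀ ∩ openConn x y)) +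
        p / (p + q * (1 - p)) * P.real ((fun η => η \ {s(x, y)}) ⁻¹' (H₀ ∩ (openConn x y)ᶜ)) := by
  classical
  haveI := hP.isProbabilityMeasure
  set f : BondConfig (Site d) → BondConfig (Site d) := fun η => η \ {s(x, y)} with hf
  have hfm : Measurable f := measurable_closeEdges _
  set p' := p / (p + q * (1 - p)) with hp'
  have hp0 : 0 ≤ p := hp.1
  have hp'0 : 0 ≤ p' := div_nonneg hp.1 (by nlinarith [hp.1, hp.2, hq])
  have hKm : MeasurableSet (openConn x y : Set (BondConfig (Site d))) := measurableSet_openConn_holds x y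
  -- the two finite measures on `T_e`-events, pushed to the base
  set μ₁ : Measure (BondConfig (Site d)) := (P.restrict {ω | s(x, y) ∈ ω}).map f with hμ₁
  set μ₂ : Measure (BondConfig (Site d)) :=
    ENNReal.ofReal p • (P.restrict (f ⁻¹' openConn x y)).map f +
      ENNReal.ofReal p' • (P.restrict (f ⁻¹' (openConn x y)ᶜ)).map f with hμ₂
  haveI : IsFiniteMeasure μ₁ := by rw [hμ₁]; infer_instance
  have hμ₁A : ∀ {A : Set (BondConfig (Site d))}, MeasurableSet A →
      μ₁ A = P ({ω | s(x, y) ∈ ω} ∩ f ⁻¹' A) := by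
    intro A hA
    rw [hμ₁, Measure.map_apply hfm hA, Measure.restrict_apply (hA.preimage hfm), Set.inter_comm]
  have hμ₂A : ∀ {A : Set (BondConfig (Site d))}, MeasurableSet A →
      μ₂ A = ENNReal.ofReal p * P (f ⁻¹' (A ∩ openConn x y)) +
        ENNReal.ofReal p' * P (f ⁻¹' (A ∩ (openConn x y)ᶜ)) := by
    intro A hA
    rw [hμ₂, Measure.add_apply, Measure.smul_apply, Measure.smul_apply, Measure.map_apply hfm hA,
      Measure.map_apply hfm hA, Measure.restrict_apply (hA.preimage hfm),
      Measure.restrict_apply (hA.preimage hfm), smul_eq_mul, smul_eq_mul, Set.preimage_inter,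
      Set.preimage_inter]
  -- they agree on local events (part 3), hence everywhere
  have hagree : μ₁ = μ₂ := by
    refine ext_of_isLocalEvent fun A hA => ?_
    obtain ⟨T₀, hT₀⟩ := hA
    have hAm : MeasurableSet A := measurableSet_of_isLocalEvent_holds ⟨T₀, hT₀⟩
    have hdet : DeterminedBy (f ⁻¹' A) ↑(T₀.erase s(x, y)) := by
      rw [Finset.coe_erase]; exact AKN.determinedBy_preimage_diff hT₀ _
    have hloc := hP.real_edgeOpen_inter_eq hp hq hxy hdet (Finset.notMem_erase _ _)
    rw [hμ₁A hAm, hμ₂A hAm, ← ofReal_measureReal, hloc, ENNReal.ofReal_add (by positivity) (by positivity),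
      ENNReal.ofReal_mul hp0, ENNReal.ofReal_mul hp'0, ofReal_measureReal, ofReal_measureReal,
      Set.preimage_inter, Set.preimage_inter, Set.preimage_compl]
  have h := congrArg (fun μ : Measure (BondConfig (Site d)) => (μ H₀).toReal) hagree
  simp only [hμ₁A hH₀, hμ₂A hH₀] at h
  rw [measureReal_def, h, ENNReal.toReal_add (by finiteness) (by finiteness), ENNReal.toReal_mul,
    ENNReal.toReal_mul, ENNReal.toReal_ofReal hp0, ENNReal.toReal_ofReal hp'0, measureReal_def,
    measureReal_def]

/-- **Edge density through (4.38)**: for every box limit `P` (`0 ≤ p ≤ 1`, `q ≥ 1`) and lattice edge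
`e = ⟨x,y⟩`, `P(e open) = p · P(x ↔ y off e) + p/(p+q(1-p)) · P(¬ x ↔ y off e)` — the one-edge DLR
equation with `H = Ω`. [cite: Grimmett2006, Prop. (4.37) eq. (4.38)] -/
theorem IsBoxLimit.real_edgeOpen_eq_mul_add (hP : IsBoxLimit d b p q P) (hp : p ∈ Set.Icc (0 : ℝ) 1)
    (hq : 1 ≤ q) {x y : Site d} (hxy : (zdGraph d).Adj x y) :
    P.real {ω | s(x, y) ∈ ω} =
      p * P.real ((fun η => η \ {s(x, y)}) ⁻¹' openConn x y) +
        p / (p + q * (1 - p)) * P.real (((fun η => η \ {s(x, y)}) ⁻¹' openConn x y)ᶜ) := by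
  have h := hP.real_edgeOpen_inter_eq hp hq hxy (H := Set.univ) (T := (∅ : Finset (Sym2 (Site d))))
    (by rw [Finset.coe_empty]; exact determinedBy_univ _) (Finset.notMem_empty _)
  simpa only [Set.inter_univ, Set.univ_inter] using h

/-- The same for `φ^b_{p,q} = rcLimit d b p q`; for `b = false` the left-hand side is the tree's
`freeEdgeDensity d p q` (`IsBoxLimit.real_setOf_mem_eq_freeEdgeDensity`, `InfiniteVolumeMeasures.lean`).
[cite: Grimmett2006, Prop. (4.37) eq. (4.38)] -/
theorem rcLimit_real_edgeOpen_eq_mul_add (b : Bool) (hp : p ∈ Set.Icc (0 : ℝ) 1) (hq : 1 ≤ q)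
    {x y : Site d} (hxy : (zdGraph d).Adj x y) :
    (rcLimit d b p q).real {ω | s(x, y) ∈ ω} =
      p * (rcLimit d b p q).real ((fun η => η \ {s(x, y)}) ⁻¹' openConn x y) +
        p / (p + q * (1 - p)) * (rcLimit d b p q).real (((fun η => η \ {s(x, y)}) ⁻¹' openConn x y)ᶜ) :=
  (isBoxLimit_rcLimit b hp hq).real_edgeOpen_eq_mul_add hp hq hxy

/-! ### The conditional expectation -/

/-- **Grimmett's (4.30)/(4.38) as a conditional expectation**: for every box limit `P` (`0 ≤ p ≤ 1`,
`q ≥ 1`, either boundary condition) and every lattice edge `e = ⟨x,y⟩`, with `T_e` the σ-algebra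
of the other edges (the pull-back `MeasurableSpace.comap (· ∖ {e})`),
`P[1_{e open} | T_e](ω) = p` if `x ↔ y` in `ω ∖ e` and `= p/(p + q(1-p))` otherwise, for `P`-a.e. `ω`:
the box limits `φ^b_{p,q}` are DLR random-cluster measures in the one-edge sense of Prop. (4.37).
[cite: Grimmett2006, Def. (4.29)–(4.30), Thm. (4.34)(b), Prop. (4.37) eq. (4.38)] -/
theorem IsBoxLimit.condExp_indicator_edgeOpen (hP : IsBoxLimit d b p q P)
    (hp : p ∈ Set.Icc (0 : ℝ) 1) (hq : 1 ≤ q) {x y : Site d} [DecidablePred (· ∈ (openConn x y : Set (BondConfig (Site d))))]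
    (hxy : (zdGraph d).Adj x y) :
    (fun ω : BondConfig (Site d) =>
        if ω \ {s(x, y)} ∈ openConn x y then p else p / (p + q * (1 - p))) =ᵐ[P]
      P[({ω : BondConfig (Site d) | s(x, y) ∈ ω}).indicator (fun _ => (1 : ℝ)) |
        MeasurableSpace.comap (fun η : BondConfig (Site d) => η \ {s(x, y)}) inferInstance] := by
  classical
  haveI := hP.isProbabilityMeasure
  set f : BondConfig (Site d) → BondConfig (Site d) := fun η => η \ {s(x, y)} with hf
  have hfm : Measurable f := measurable_closeEdges _
  have hm : MeasurableSpace.comap f inferInstance ≤ (inferInstance : MeasurableSpace (BondConfig (Site d))) :=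
    measurable_iff_comap_le.1 hfm
  have hKm : MeasurableSet (openConn x y : Set (BondConfig (Site d))) := measurableSet_openConn_holds x y
  have hJm : MeasurableSet {ω : BondConfig (Site d) | s(x, y) ∈ ω} := measurableSet_mem _
  set p' := p / (p + q * (1 - p)) with hp'
  -- the kernel as a combination of indicators of `T_e`-events
  set g : BondConfig (Site d) → ℝ := fun ω => if ω \ {s(x, y)} ∈ openConn x y then p else p' with hg
  have hg_eq : g = (f ⁻¹' openConn x y).indicator (fun _ => p) + (f ⁻¹' (openConn x y)ᶜ).indicator (fun _ => p') := by
    funext ω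
    by_cases h : ω \ {s(x, y)} ∈ openConn x y
    · simp [hg, h, hf]
    · simp [hg, h, hf]
  -- measurability of `g` with respect to `T_e`
  have hgm : Measurable[MeasurableSpace.comap f inferInstance] g := by
    have h1 : Measurable[MeasurableSpace.comap f inferInstance] f := measurable_iff_comap_le.2 le_rfl
    have h2 : Measurable fun η : BondConfig (Site d) => if η ∈ openConn x y then p else p' :=
      Measurable.ite hKm measurable_const measurable_const
    exact h2.comp h1
  refine ae_eq_condExp_of_forall_setIntegral_eq hm ((integrable_const (1 : ℝ)).indicator hJm)
    (fun s _ _ => ?_) (fun s hs _ => ?_) hgm.stronglyMeasurable.aestronglyMeasurable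
  · -- `g` is bounded, hence integrable on every set
    rw [hg_eq]
    exact (((integrable_const p).indicator (hKm.preimage hfm)).add
      ((integrable_const p').indicator (hKm.compl.preimage hfm))).integrableOn
  · -- the set integrals agree: this is `real_edgeOpen_inter_preimage_eq`
    obtain ⟨H₀, hH₀, rfl⟩ := MeasurableSpace.measurableSet_comap.1 hs
    have hI1 : IntegrableOn ((f ⁻¹' openConn x y).indicator fun _ => p) (f ⁻¹' H₀) P :=
      ((integrable_const p).indicator (hKm.preimage hfm)).integrableOn
    have hI2 : IntegrableOn ((f ⁻¹' (openConn x y)ᶜ).indicator fun _ => p') (f ⁻¹' H₀) P :=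
      ((integrable_const p').indicator (hKm.compl.preimage hfm)).integrableOn
    rw [hg_eq]
    simp only [Pi.add_apply]
    rw [integral_add hI1 hI2, setIntegral_indicator (hKm.preimage hfm),
      setIntegral_indicator (hKm.compl.preimage hfm), setIntegral_const, setIntegral_const, smul_eq_mul,
      smul_eq_mul, setIntegral_indicator hJm, setIntegral_const, smul_eq_mul, mul_one,
      Set.inter_comm (f ⁻¹' H₀) {ω | s(x, y) ∈ ω}, hP.real_edgeOpen_inter_preimage_eq hp hq hxy hH₀,
      Set.preimage_inter, Set.preimage_inter, Set.preimage_compl]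
    ring

end General

end Summit.CriticalPhenomena.PercolationContinuityZ3.Theorems.FK

end
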